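import Mathlib
import Summits.Ventures.HodgeRepro2.T5QuadraticAutomorphism

/-!
# The Galois conjugation as the star of the inert-place package

Blind cell `pub-hodge-repro2`, seat p8 (gen 13), Tier-5 kernel support.  The inert-place Hecke
package (`T5UnitaryHeckeAdjoint`, `T5CartanUnitaryThree`, `T5UnitaryThreeHecke`) is stated for a
field `E` carrying a `StarRing` instance and a subring `R` whose integrality the star preserves
(the hypothesis `hstar`).  In the record the star is the Galois conjugation of the quadratic
extension `E_v / F_v` and `R` is the ring of integers of `E_v`.  This file is the first half of
that reading, the star:

* `starRingOfInvolution τ hτ` — the `StarRing` structure on a commutative ring from an involutive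
  ring automorphism `τ` (a definition, not an instance: the trivial star `starRingOfComm` of the
  `ℚ_p` instances must stay available);
* `isInteger_star_of_forall_exists` — the star preserves `R`-integrality as soon as `τ` maps the
  image of `R` into itself;
* `map_mem_integralClosure` / `isInteger_integralClosure_star` — an `F`-algebra automorphism maps
  the integral closure of `R₀ ⊆ F` in `E` into itself (`IsIntegral.map`), so `hstar` holds for
  `R := integralClosure R₀ E` with the star `τ` and NO further hypothesis;
* `star_algebraMap_of_algEquiv` / `star_algebraMap_base` — the star fixes the image of `F`
  pointwise, hence every uniformiser and every unit taken from `F` (the hypotheses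
  `star ϖ = ϖ`, `star u = u` of the package);
* `starRingOfQuadratic` / `star_eq_self_iff_mem_range` — the `StarRing` of a quadratic extension
  with a non-trivial automorphism, whose fixed points are exactly `F` (p4's
  `T5QuadraticAutomorphism.apply_apply` / `mem_range_of_fixed`, p399047), and the existence of
  that automorphism when `E / F` is Galois of degree `2` (`exists_ne_one_of_finrank_eq_two`).

README §8(d): uses an L-value-free non-vanishing device: NO.
-/

namespace Summit.Ventures.HodgeRepro2.T5StarOfInvolution

open IsLocalization

section General

variable {E : Type*} [CommRing E]

/-- The `StarRing` structure on a commutative ring given by an involutive ring automorphism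
`τ` (`star x = τ x`).  A reducible definition, not an instance. -/
abbrev starRingOfInvolution (τ : E ≃+* E) (hτ : ∀ x, τ (τ x) = x) : StarRing E where
  star := τ
  star_involutive := hτ
  star_mul x y := by
    show τ (x * y) = τ y * τ x
    rw [map_mul, mul_comm]
  star_add x y := map_add τ x y

/-- In `starRingOfInvolution τ hτ` the star is `τ`. -/
theorem star_eq (τ : E ≃+* E) (hτ : ∀ x, τ (τ x) = x) (x : E) :
    letI := starRingOfInvolution τ hτ
    star x = τ x :=
  rfl

/-- A fixed point of `τ` is a self-adjoint element of `starRingOfInvolution τ hτ`. -/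
theorem star_eq_self_of_fixed (τ : E ≃+* E) (hτ : ∀ x, τ (τ x) = x) {x : E} (hx : τ x = x) :
    letI := starRingOfInvolution τ hτ
    star x = x :=
  hx

/-- `R`-integrality is preserved by the star as soon as `τ` maps the image of `R` into itself
(the hypothesis `hstar` of the inert-place package). -/
theorem isInteger_star_of_forall_exists {R : Type*} [CommRing R] [Algebra R E] (τ : E ≃+* E)
    (hτ : ∀ x, τ (τ x) = x)
    (hR : ∀ r : R, ∃ r' : R, τ (algebraMap R E r) = algebraMap R E r') (x : E)
    (hx : IsInteger R x) :
    letI := starRingOfInvolution τ hτ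
    IsInteger R (star x) := by
  obtain ⟨r, rfl⟩ := hx
  obtain ⟨r', hr'⟩ := hR r
  exact ⟨r', hr'.symm⟩

end General

section IntegralClosure

variable {R₀ F E : Type*} [CommRing R₀] [Field F] [CommRing E] [Algebra R₀ F] [Algebra F E]
  [Algebra R₀ E] [IsScalarTower R₀ F E]

/-- An `F`-algebra automorphism of `E` maps the integral closure of `R₀` in `E` into itself. -/
theorem map_mem_integralClosure (τ : E ≃ₐ[F] E) {x : E} (hx : x ∈ integralClosure R₀ E) :
    τ x ∈ integralClosure R₀ E := by
  rw [mem_integralClosure_iff] at hx ⊢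
  exact hx.map τ

/-- `IsInteger` for the integral closure is membership in it. -/
theorem isInteger_integralClosure_iff (x : E) :
    IsInteger (integralClosure R₀ E) x ↔ x ∈ integralClosure R₀ E := by
  constructor
  · rintro ⟨r, rfl⟩
    exact r.2
  · intro h
    exact ⟨⟨x, h⟩, rfl⟩

/-- **The hypothesis `hstar` of the inert-place package for `R := integralClosure R₀ E` and the
star `τ`**: an involutive `F`-algebra automorphism preserves integrality over the integral
closure, with no further hypothesis. -/
theorem isInteger_integralClosure_star (τ : E ≃ₐ[F] E) (hτ : ∀ x, τ (τ x) = x) (x : E)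
    (hx : IsInteger (integralClosure R₀ E) x) :
    letI := starRingOfInvolution (τ : E ≃+* E) hτ
    IsInteger (integralClosure R₀ E) (star x) := by
  rw [isInteger_integralClosure_iff] at hx
  exact (isInteger_integralClosure_iff (τ x)).mpr (map_mem_integralClosure τ hx)

/-- The star `τ` fixes the image of `F` pointwise. -/
theorem star_algebraMap_of_algEquiv (τ : E ≃ₐ[F] E) (hτ : ∀ x, τ (τ x) = x) (a : F) :
    letI := starRingOfInvolution (τ : E ≃+* E) hτ
    star (algebraMap F E a) = algebraMap F E a :=
  τ.commutes a

/-- The star `τ` fixes the image of `R₀` pointwise (uniformisers and units of `R₀`). -/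
theorem star_algebraMap_base (τ : E ≃ₐ[F] E) (hτ : ∀ x, τ (τ x) = x) (r : R₀) :
    letI := starRingOfInvolution (τ : E ≃+* E) hτ
    star (algebraMap R₀ E r) = algebraMap R₀ E r := by
  rw [IsScalarTower.algebraMap_apply R₀ F E]
  exact τ.commutes _

/-- The star `τ` fixes the image of `R₀` inside the integral closure. -/
theorem star_algebraMap_integralClosure (τ : E ≃ₐ[F] E) (hτ : ∀ x, τ (τ x) = x) (r : R₀) :
    letI := starRingOfInvolution (τ : E ≃+* E) hτ
    star (algebraMap (integralClosure R₀ E) E (algebraMap R₀ (integralClosure R₀ E) r)) =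
      algebraMap (integralClosure R₀ E) E (algebraMap R₀ (integralClosure R₀ E) r) := by
  rw [← IsScalarTower.algebraMap_apply R₀ (integralClosure R₀ E) E]
  exact star_algebraMap_base τ hτ r

end IntegralClosure

section Quadratic

variable {F E : Type*} [Field F] [Field E] [Algebra F E] [FiniteDimensional F E]

/-- The `StarRing` of a quadratic extension `E / F` from a non-trivial `F`-automorphism `σ`
(involutive by p4's `T5QuadraticAutomorphism.apply_apply`). -/
abbrev starRingOfQuadratic (h2 : Module.finrank F E = 2) (σ : E ≃ₐ[F] E) (hσ : σ ≠ 1) :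
    StarRing E :=
  starRingOfInvolution (σ : E ≃+* E) (T5QuadraticAutomorphism.apply_apply h2 σ hσ)

/-- In the star of a quadratic extension the self-adjoint elements are exactly the image of
`F` (p4's `mem_range_of_fixed` and `σ.commutes`). -/
theorem star_eq_self_iff_mem_range (h2 : Module.finrank F E = 2) (σ : E ≃ₐ[F] E) (hσ : σ ≠ 1)
    (z : E) :
    letI := starRingOfQuadratic h2 σ hσ
    star z = z ↔ z ∈ Set.range (algebraMap F E) := by
  constructor
  · intro hz
    exact T5QuadraticAutomorphism.mem_range_of_fixed h2 σ hσ hz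
  · rintro ⟨a, rfl⟩
    exact σ.commutes a

/-- A Galois extension of degree `2` has a non-trivial automorphism. -/
theorem exists_ne_one_of_finrank_eq_two [IsGalois F E] (h2 : Module.finrank F E = 2) :
    ∃ σ : E ≃ₐ[F] E, σ ≠ 1 := by
  have hcard : Nat.card (E ≃ₐ[F] E) = 2 := by
    rw [IsGalois.card_aut_eq_finrank]
    exact h2
  obtain ⟨σ, hσ, -⟩ := (Nat.card_eq_two_iff' (1 : E ≃ₐ[F] E)).mp hcard
  exact ⟨σ, hσ⟩

end Quadratic

end Summit.Ventures.HodgeRepro2.T5StarOfInvolution
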